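import Summits.AtomisticToContinuum.HydrodynamicLimit.Theorems.CollisionIsometryCLTCollisionalTransferLocalityDefs
import Literature.MathematicalPhysics.KineticTheory.HardSphereEulerProofs
import HarnessLib

/-!
# Gaussian velocity marks for the equilibrium rung of the line `hemisphere-affine-slaving`

Helper file (`--supports stmt-AtomisticToContinuum-9518`, line `hemisphere-affine-slaving`, skeleton
v10.1) for the crux `CollisionalTransferLocality`: the four registered Gaussian-moment stubs of the
equilibrium rung. Under the homogeneous local Gibbs law the velocities are, conditionally on the
positions, i.i.d. with the isotropic centred Gaussian law `gaussMeasure 0 θ` on `V3 = ℝ³`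
(`Literature.MathematicalPhysics.KineticTheory.gaussMeasure`, the image of Mathlib's `stdGaussian`
under `w ↦ 0 + √θ • w`), and the free-streaming term of the balance law is an empirical average of the
marks `v_a v_b` and `v_a |v|²`. The Chebyshev step (`localGibbsMeasure_velFluct_le`) needs exactly:

* `integral_coord_mul_coord_gaussMeasure_zero` : `∫ v_a v_b dN(0, θ) = θ δ_ab` (`0 < θ`);
* `integral_coord_mul_norm_sq_gaussMeasure_zero` : `∫ v_a |v|² dN(0, θ) = 0` (`0 < θ`);
* `memLp_two_coord_mul_coord_gaussMeasure` : `v ↦ v_a v_b ∈ L²(N(0, θ))` (every real `θ`);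
* `memLp_two_coord_mul_norm_sq_gaussMeasure` : `v ↦ v_a |v|² ∈ L²(N(0, θ))` (every real `θ`).

Proofs. The second moments are Mathlib's covariance matrix of the multivariate Gaussian
(`gaussMeasure_eq_multivariateGaussian`, `ProbabilityTheory.covariance_eval_multivariateGaussian`,
`ProbabilityTheory.covariance_eq_sub`) together with the vanishing means
(`integral_coord_gaussMeasure`). The third moments vanish because the integrand is odd under the
linear isometry `v ↦ -v`, which preserves `stdGaussian` (`ProbabilityTheory.stdGaussian_map`). The `L²`
statements follow by domination, `|v_a v_b| ≤ |v|²`, `|v_a| |v|² ≤ |v|³` (`PiLp.norm_apply_le`), from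
the finiteness of all norm moments of a Gaussian measure (`ProbabilityTheory.IsGaussian.memLp_id`,
Fernique); for `θ ≤ 0` the law degenerates (`√θ = 0`) to a Dirac mass, still Gaussian, so the two
`MemLp` statements hold for every real `θ` as registered. Everything here is folklore Gaussian
calculus; nothing is cited and no dynamics enters.
-/

namespace Summit.AtomisticToContinuum.HydrodynamicLimit.Theorems.HemisphereAffineSlaving

open scoped BigOperators Topology Classical ENNReal InnerProductSpace
open Filter Set Function MeasureTheory

noncomputable section

open Literature.MathematicalPhysics.KineticTheory (T3 V3)
open ProbabilityTheory
open Literature.MathematicalPhysics.KineticTheory (gaussMeasure gaussMeasure_eq_multivariateGaussian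
  integral_gaussMeasure integral_coord_gaussMeasure memLp_coord_gaussMeasure)

/-! ### Norm moments and the two `L²` marks -/

/-- Every power of the speed is square integrable under the centred isotropic Gaussian
`gaussMeasure 0 θ` on `ℝ³` (all norm moments of a Gaussian measure are finite, Fernique:
`IsGaussian.memLp_id`; cf. the tree's `OneFlightGossipEngineHeatFlux.integrable_norm_pow_gaussMeasure`
for the `L¹` form, not imported here to keep this line's import closure inside its own route).
[folklore] -/
theorem memLp_two_norm_pow_gaussMeasure_zero (θ : ℝ) (n : ℕ) :
    MemLp (fun v : V3 => ‖v‖ ^ n) 2 (gaussMeasure (0 : V3) θ) := by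
  rw [memLp_two_iff_integrable_sq (by fun_prop)]
  simpa only [← pow_mul, id_eq] using (IsGaussian.memLp_id (gaussMeasure (0 : V3) θ) ((n * 2 : ℕ) : ℝ≥0∞)
    (ENNReal.natCast_ne_top _)).integrable_norm_pow'

/-- **`L²` mark, second moments**: for every real `θ` and `a b : Fin 3`, the quadratic mark
`v ↦ v_a v_b` is in `L²(gaussMeasure 0 θ)` (domination `|v_a v_b| ≤ |v|²`). [folklore] -/
theorem memLp_two_coord_mul_coord_gaussMeasure : ∀ (θ : ℝ) (a b : Fin 3), MemLp (fun v : V3 => v a * v b) 2 (Literature.MathematicalPhysics.KineticTheory.gaussMeasure (0 : V3) θ) := by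
  intro θ a b
  refine (memLp_two_norm_pow_gaussMeasure_zero θ 2).mono'
    (((EuclideanSpace.proj (𝕜 := ℝ) a).continuous.mul
      (EuclideanSpace.proj (𝕜 := ℝ) b).continuous).aestronglyMeasurable)
    (Eventually.of_forall fun v => ?_)
  rw [norm_mul, pow_two]
  exact mul_le_mul (PiLp.norm_apply_le v a) (PiLp.norm_apply_le v b) (norm_nonneg _)
    (norm_nonneg _)

/-- **`L²` mark, third moments**: for every real `θ` and `a : Fin 3`, the cubic mark
`v ↦ v_a |v|²` is in `L²(gaussMeasure 0 θ)` (domination `|v_a| |v|² ≤ |v|³`). [folklore] -/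
theorem memLp_two_coord_mul_norm_sq_gaussMeasure : ∀ (θ : ℝ) (a : Fin 3), MemLp (fun v : V3 => v a * ‖v‖ ^ 2) 2 (Literature.MathematicalPhysics.KineticTheory.gaussMeasure (0 : V3) θ) := by
  intro θ a
  refine (memLp_two_norm_pow_gaussMeasure_zero θ 3).mono'
    (((EuclideanSpace.proj (𝕜 := ℝ) a).continuous.mul
      ((continuous_norm).pow 2)).aestronglyMeasurable)
    (Eventually.of_forall fun v => ?_)
  rw [norm_mul, norm_pow, norm_norm, pow_succ' ‖v‖ 2]
  exact mul_le_mul_of_nonneg_right (PiLp.norm_apply_le v a) (by positivity)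

/-! ### Second moments: the covariance matrix `θ • 1` -/

/-- **Second velocity moments of the centred Maxwellian**: for `0 < θ` and `a b : Fin 3`,
`∫ v_a v_b d(gaussMeasure 0 θ) = θ δ_ab` — the covariance matrix of
`gaussMeasure 0 θ = multivariateGaussian 0 (θ • 1)` is `θ • 1` and the means vanish. [folklore] -/
theorem integral_coord_mul_coord_gaussMeasure_zero : ∀ {θ : ℝ}, 0 < θ → ∀ a b : Fin 3, ∫ v, v a * v b ∂(Literature.MathematicalPhysics.KineticTheory.gaussMeasure (0 : V3) θ) = if a = b then θ else 0 := by
  intro θ hθ a b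
  have hS : (θ • (1 : Matrix (Fin 3) (Fin 3) ℝ)).PosSemidef := Matrix.PosSemidef.one.smul hθ.le
  have hcov := covariance_eval_multivariateGaussian (μ := (0 : V3)) hS a b
  rw [← gaussMeasure_eq_multivariateGaussian (0 : V3) hθ.le,
    covariance_eq_sub (memLp_coord_gaussMeasure (0 : V3) θ a 2 (by simp))
      (memLp_coord_gaussMeasure (0 : V3) θ b 2 (by simp))] at hcov
  have ha : ∫ v, v a ∂gaussMeasure (0 : V3) θ = 0 := by
    rw [integral_coord_gaussMeasure (0 : V3) hθ a]; rfl
  have hb : ∫ v, v b ∂gaussMeasure (0 : V3) θ = 0 := by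
    rw [integral_coord_gaussMeasure (0 : V3) hθ b]; rfl
  simp only [Pi.mul_apply, ha, hb, mul_zero, sub_zero, Matrix.smul_apply, Matrix.one_apply,
    smul_eq_mul, mul_ite, mul_one, mul_zero] at hcov
  exact hcov

/-! ### Third moments vanish by the symmetry `v ↦ -v` -/

/-- An integrand on `ℝ³` that is odd under `w ↦ -w` has zero integral against the standard Gaussian
(the standard Gaussian is invariant under the linear isometry `-id`; no integrability needed, the
junk value `0` being odd too). [folklore] -/
theorem integral_stdGaussian_eq_zero_of_odd_neg {g : V3 → ℝ} (hg : ∀ w, g (-w) = -g w) :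
    ∫ w, g w ∂stdGaussian V3 = 0 := by
  have hmp : MeasurePreserving (LinearIsometryEquiv.neg ℝ : V3 ≃ₗᵢ[ℝ] V3) (stdGaussian V3)
      (stdGaussian V3) :=
    ⟨(LinearIsometryEquiv.neg ℝ : V3 ≃ₗᵢ[ℝ] V3).continuous.measurable, stdGaussian_map _⟩
  have h := hmp.integral_comp
    (LinearIsometryEquiv.neg ℝ : V3 ≃ₗᵢ[ℝ] V3).toHomeomorph.measurableEmbedding g
  simp only [LinearIsometryEquiv.coe_neg, hg, integral_neg] at h
  linarith

/-- **Third velocity moments of the centred Maxwellian vanish**: for `0 < θ` and `a : Fin 3`,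
`∫ v_a |v|² d(gaussMeasure 0 θ) = 0` — after the change of variables `v = √θ w`
(`integral_gaussMeasure`) the integrand is odd under `w ↦ -w`. [folklore] -/
theorem integral_coord_mul_norm_sq_gaussMeasure_zero : ∀ {θ : ℝ}, 0 < θ → ∀ a : Fin 3, ∫ v, v a * ‖v‖ ^ 2 ∂(Literature.MathematicalPhysics.KineticTheory.gaussMeasure (0 : V3) θ) = 0 := by
  intro θ hθ a
  rw [integral_gaussMeasure (0 : V3) hθ]
  refine integral_stdGaussian_eq_zero_of_odd_neg fun w => ?_
  simp only [zero_add, smul_neg, norm_neg, PiLp.neg_apply, neg_mul]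

end

end Summit.AtomisticToContinuum.HydrodynamicLimit.Theorems.HemisphereAffineSlaving
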